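import Literature.Probability.LatticeModels.ModifiedSimonInequality
import Literature.Probability.LatticeModels.CriticalTwoPointDCPLowerTorus
import Literature.Probability.LatticeModels.SharpnessProofs
import HarnessLib

/-!
# RobustBall/IsingSetDecay — the Simon–Lieb LADDER ENGINE: two-point decay of the free-boundary Ising model on a finite graph from a
# finite-set certificate `φ_β(S_a) ≤ φ₀` (any family of sets `S_a ∋ a` of `ℓ`-radius `≤ r`)

HONEST FRAMING: venture file of the cell `pub-ymgap` (QuantumFields programme), track Y2 ROBUST-BALL / DS seat ds-4 (g9).  A finite-volume statement
about the classical Ising model (free boundary condition, zero field, `β ≥ 0`) on an arbitrary finite graph; written as the ENGINE of the `β`-ladder for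
the centre-blind window of `SU(2)` lattice gauge theory (`CentreBlindStarWindow`: rung 2 = stars; rung `k+1` = Simon–Lieb sets `B_k` with a COMPUTED
certificate).  Nothing about the continuum; no claim beyond the displayed inequality.

WHAT.  Let `ℓ : V → ℕ` be `1`-Lipschitz along edges with `ℓ z = 0`, `z ∈ Λ`; let every site `a ∈ Λ` carry a finite set `S_a ⊆ Λ` with `a ∈ S_a`
and `ℓ a ≤ ℓ x + r` for `x ∈ S_a` (radius `r`); and suppose the CERTIFICATE
`φ_β(S_a) := ∑_{x ∈ S_a} ∑_{y ∈ Λ ∖ S_a, y ∼ x} tanh β · ⟨σ_a σ_x⟩^∅_{S_a;β} ≤ φ₀` for every `a ∈ Λ`.  Then for every `a ∈ Λ` with `(r+1)·n ≤ ℓ a`: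
`⟨σ_a σ_z⟩^∅_{Λ;β} ≤ φ₀^n` (`isingTwoPoint_free_le_pow_of_certificate`).  MECHANISM: the modified Simon inequality (Duminil-Copin–Tassion 2016,
Lemma 2.7 = the tree's `isingTwoPoint_free_le_modifiedSimon`, random currents) exits `S_a` at a site `y` with `ℓ y ≥ ℓ a − (r+1)`; induction on `n`;
GKS I for the signs.  `IsingStarDecay` is the instance `S_a` = star, `r = 1`, `φ₀ = Δ(Δ−1) tanh²β` on triangle-free graphs.

References: B. Simon, Comm. Math. Phys. 77 (1980) 111, Thm. 2.1; E. Lieb, Comm. Math. Phys. 77 (1980) 127; H. Duminil-Copin, V. Tassion,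
Comm. Math. Phys. 343 (2016) 725, Lemma 2.7 [DuminilCopinTassionCMP2016]; Friedli–Velenik 2017 §3.6–3.8 (GKS).
-/

noncomputable section

open Finset
open Literature.Probability.LatticeModels

namespace Summit.Ventures.YMGap.RobustBall

namespace IsingStar

variable {V : Type*} [DecidableEq V] (G : SimpleGraph V) [G.LocallyFinite] [DecidableRel G.Adj]

/-- **THE SIMON–LIEB LADDER ENGINE**: two-point decay `⟨σ_a σ_z⟩^∅_{Λ;β} ≤ φ₀^n` for `(r+1) n ≤ ℓ a`, from a finite-set certificate
`φ_β(S_a) ≤ φ₀` for a family of sets `S_a ∋ a` of `ℓ`-radius `≤ r` inside `Λ` (`β ≥ 0`, `ℓ` `1`-Lipschitz along edges, `ℓ z = 0`).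
[cite: DuminilCopinTassionCMP2016, Lemma 2.7] -/
theorem isingTwoPoint_free_le_pow_of_certificate {β : ℝ} (hβ : 0 ≤ β) {Λ : Finset V} (S : V → Finset V) (r : ℕ) {φ₀ : ℝ}
    (hSΛ : ∀ a ∈ Λ, S a ⊆ Λ) (haS : ∀ a ∈ Λ, a ∈ S a) (ℓ : V → ℕ) (hℓS : ∀ a ∈ Λ, ∀ x ∈ S a, ℓ a ≤ ℓ x + r)
    (hℓ : ∀ x y, G.Adj x y → ℓ x ≤ ℓ y + 1) {z : V} (hz : ℓ z = 0) (hzΛ : z ∈ Λ)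
    (hφ : ∀ a ∈ Λ, ∑ x ∈ S a, ∑ _y ∈ (Λ \ S a).filter (G.Adj x),
      Real.tanh β * isingTwoPoint G (S a) β 0 .free a x ≤ φ₀) :
    ∀ (n : ℕ) (a : V), a ∈ Λ → (r + 1) * n ≤ ℓ a → isingTwoPoint G Λ β 0 .free a z ≤ φ₀ ^ n := by
  have ht0 : 0 ≤ Real.tanh β := by
    rw [Real.tanh_eq_sinh_div_cosh]; exact div_nonneg (Real.sinh_nonneg_iff.2 hβ) (Real.cosh_pos β).le
  intro n
  induction n with
  | zero =>
      intro a _ _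
      rw [pow_zero]
      exact (le_abs_self _).trans (abs_isingTwoPoint_le_one G Λ β 0 .free a z)
  | succ n ih =>
      intro a ha hna
      -- `z` is outside `S_a`
      have hzS : z ∉ S a := fun hzS' => by
        have h := hℓS a ha z hzS'
        rw [hz] at h
        have : (r + 1) * (n + 1) ≥ r + 1 := Nat.le_mul_of_pos_right _ (Nat.succ_pos n)
        omega
      refine (isingTwoPoint_free_le_modifiedSimon G hβ (hSΛ a ha) (haS a ha) hzΛ hzS).trans ?_
      -- every exit point is at `ℓ`-height `≥ ℓ a − (r+1) ≥ (r+1) n`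
      have hterm : ∀ x ∈ S a, ∀ y ∈ (Λ \ S a).filter (G.Adj x),
          Real.tanh β * isingTwoPoint G (S a) β 0 .free a x * isingTwoPoint G Λ β 0 .free y z ≤
            Real.tanh β * isingTwoPoint G (S a) β 0 .free a x * φ₀ ^ n := by
        intro x hx y hy
        rw [mem_filter, mem_sdiff] at hy
        have h1 := hℓS a ha x hx
        have h2 := hℓ x y hy.2
        have hIH := ih y hy.1.1 (by
          have : (r + 1) * (n + 1) = (r + 1) * n + (r + 1) := by ring
          omega)
        exact mul_le_mul_of_nonneg_left hIH
          (mul_nonneg ht0 (DCPLower.isingTwoPoint_free_nonneg_of_mem G hβ (haS a ha) hx))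
      calc ∑ x ∈ S a, ∑ y ∈ (Λ \ S a).filter (G.Adj x),
            Real.tanh β * isingTwoPoint G (S a) β 0 .free a x * isingTwoPoint G Λ β 0 .free y z
          ≤ ∑ x ∈ S a, ∑ y ∈ (Λ \ S a).filter (G.Adj x), Real.tanh β * isingTwoPoint G (S a) β 0 .free a x * φ₀ ^ n :=
            sum_le_sum fun x hx => sum_le_sum fun y hy => hterm x hx y hy
        _ = (∑ x ∈ S a, ∑ y ∈ (Λ \ S a).filter (G.Adj x), Real.tanh β * isingTwoPoint G (S a) β 0 .free a x) * φ₀ ^ n := by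
            rw [sum_mul]; refine sum_congr rfl fun x _ => ?_; rw [sum_mul]
        _ ≤ φ₀ * φ₀ ^ n := by
            have hφn : 0 ≤ φ₀ ^ n := by
              rcases n with _ | n
              · simp
              · -- `φ₀ ≥ 0` follows from the certificate at `a` (a sum of nonnegative terms)
                have hφ0 : 0 ≤ φ₀ := le_trans (sum_nonneg fun x hx => sum_nonneg fun y _ =>
                  mul_nonneg ht0 (DCPLower.isingTwoPoint_free_nonneg_of_mem G hβ (haS a ha) hx)) (hφ a ha)
                exact pow_nonneg hφ0 _
            exact mul_le_mul_of_nonneg_right (hφ a ha) hφn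
        _ = φ₀ ^ (n + 1) := by ring

end IsingStar

end Summit.Ventures.YMGap.RobustBall

end
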